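import Summits.QuantumAdvantage.QuantumAdvantage.Theorems.LinnikCubicClassGroupsDegreeOnePrimesEscapeCyclotomicPNT
import Literature.NumberTheory.NumberFields.ArithmeticEquivalenceProofs
import Mathlib.NumberTheory.RamificationInertia.Galois
import HarnessLib

/-!
# Linnik's theorem for cosets of a congruence class group, XIV: the least prime `p ≡ a (mod q)` splitting
# completely in a Galois number field

Topic `Summits/QuantumAdvantage/QuantumAdvantage/Theorems`, cell B2b-1 (linnik-cubic), PART A (gen 25); helper toward
the crux `DegreeOnePrimesEscape` (stmt-QuantumAdvantage-11543) of route `LinnikCubicClassGroups`.  HONEST FRAMING: the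
value of this file is a THEOREM (kernel-checked, GRH-free, Siegel-free) — NOT summit progress (the route still rests on
the hypothesis-type target `PureCubicClassNumberHard`).

* `splittingType_eq_replicate_one_of_prime_absNorm` — in a Galois number field `K/ℚ`, a rational prime `p ∤ d_K` below
  a prime of residue degree one splits completely: `splittingType K p = {1, …, 1}` (`[K:ℚ]` entries);
* `exists_degOnePrime_absNorm_modEq_not_dvd_discr` — for every `K` of degree `n > 1`, `q ≥ 1` and ideal `𝔞 ≠ 0`
  prime to `q`: a degree-one prime `𝔭 ∤ q` of `K` with `N𝔭 = p ≡ N𝔞 (mod q)`, `p ∤ d_K`, `p ≤ (|d_K| q)^{L(n)}`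
  (file XII gives such a prime possibly above `d_K`; an auxiliary prime of norm `> |d_K|^n` in the same norm class,
  from the short-interval theorem of file XIII, moves the question to level `q·|d_K|`);
* `exists_prime_modEq_splittingType_eq_replicate` — **Linnik's theorem for the primes `p ≡ a (mod q)` that split
  completely in a Galois number field**: for `n > 1` there is `L = L(n) > 0` such that for every GALOIS `K/ℚ` of
  degree `n`, every `q ≥ 1` and every residue `a = N𝔞 mod q` of an ideal prime to `q`, there is a prime
  `p ≡ a (mod q)`, `p ∤ d_K`, splitting completely in `K`, with `p ≤ (|d_K| q)^L` — uniformly in `q`; the tree's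
  Lagarias–Montgomery–Odlyzko-type bound for the compositum `K(ζ_q)` (`exists_prime_isArithFrobAt_le_all`) is
  `|d_{K(ζ_q)}|^{L(n φ(q))}` with an exponent growing with `q`;
* `exists_prime_modEq_one_splittingType_eq_replicate`, `exists_prime_modEq_one_of_degOne` — the case `a = 1`
  (least prime splitting completely in `K(ζ_m)`; for arbitrary `K`, a prime `p ≡ 1 (mod m)` with a degree-one factor);
* `mem_range_cycloChar_iff_exists_degOnePrime` — the norm residues `mod m` of ideals of `K` prime to `m` are exactly
  `χ_m(Gal(K(ζ_m)/K))`, each the residue of a degree-one prime of norm `≤ (|d_K| m)^L` (effective weak Chebotarev).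
Short-interval versions and a Siegel-free lower bound for these counts: file XVII (`…CyclotomicAPBounds.lean`).
In print: a special case of Weiss 1983 Thm 6.4 / Thorner–Zaman 2017 Thm 1.1 (`L = K(ζ_q)`, `F = ℚ`, abelian
subgroup `Gal(K(ζ_q)/K)`, explicit `D_K^{694} Q^{521} + D_K^{232} Q^{367} n_K^{290 n_K}`); ours is kernel-checked with
an inexplicit `L(n)` — certification value, not a new bound.
References: [Weiss1983] Thm 6.4, §6; [ThornerZaman2017] Thm 1.1, Thm 3.1; [TateGCFT1967] Ch. VII §3.4.
-/

noncomputable section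

open Complex Real Set Filter Topology NumberField IsDedekindDomain
open scoped NumberField nonZeroDivisors

namespace Summit.QuantumAdvantage.QuantumAdvantage.Theorems.DegreeOnePrimesEscape

open Literature.NumberTheory.LFunctions Literature.NumberTheory.LFunctions.NumberField
  Literature.NumberTheory.LFunctions.AbelianDensity Literature.NumberTheory.GaloisRepresentations
  Literature.NumberTheory.NumberFields UniqueFactorizationMonoid
open scoped Classical

/-! ### Galois fields: a degree-one prime above `p ∤ d_K` means `p` splits completely -/

section Galois

variable {K : Type} [Field K] [NumberField K]

omit [NumberField K] in
/-- A prime of `𝓞 K` containing the rational prime `p` lies over `(p) ⊂ ℤ`. -/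
theorem liesOver_span_of_natCast_mem {p : ℕ} (hp : p.Prime) {P : Ideal (𝓞 K)} [P.IsPrime]
    (hP : (p : 𝓞 K) ∈ P) : P.LiesOver (Ideal.span {(p : ℤ)}) := by
  haveI hmax : (Ideal.span {(p : ℤ)}).IsMaximal :=
    ((Ideal.span_singleton_prime (by exact_mod_cast hp.ne_zero)).mpr
      (Nat.prime_iff_prime_int.mp hp)).isMaximal
        (by rw [ne_eq, Ideal.span_singleton_eq_bot]; exact_mod_cast hp.ne_zero)
  refine ⟨(hmax.eq_of_le (Ideal.comap_ne_top _ ‹P.IsPrime›.ne_top) ?_)⟩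
  rw [Ideal.span_singleton_le_iff_mem, Ideal.mem_comap, map_natCast]
  exact hP

/-- **In a Galois number field, a prime `p ∤ d_K` with a degree-one prime above it splits completely**:
`splittingType K p = {1,…,1}` with `[K:ℚ]` entries (all residue degrees above `p` agree, Mathlib
`Ideal.inertiaDeg_eq_of_isGaloisGroup`; `Σ f_i = [K:ℚ]` at an unramified prime, tree `sum_splittingType_eq_finrank`). -/
theorem splittingType_eq_replicate_one_of_prime_absNorm [IsGalois ℚ K] (v : HeightOneSpectrum (𝓞 K))
    (hp : (Ideal.absNorm v.asIdeal).Prime) (hd : ¬ ((Ideal.absNorm v.asIdeal : ℕ) : ℤ) ∣ NumberField.discr K) :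
    splittingType K (Ideal.absNorm v.asIdeal) = Multiset.replicate (Module.finrank ℚ K) 1 := by
  set p : ℕ := Ideal.absNorm v.asIdeal with hpdef
  haveI := v.isPrime
  have hpv : (p : 𝓞 K) ∈ v.asIdeal := Ideal.absNorm_mem v.asIdeal
  haveI hv_over : v.asIdeal.LiesOver (Ideal.span {(p : ℤ)}) := liesOver_span_of_natCast_mem hp hpv
  haveI hmax : (Ideal.span {(p : ℤ)}).IsMaximal :=
    ((Ideal.span_singleton_prime (by exact_mod_cast hp.ne_zero)).mpr
      (Nat.prime_iff_prime_int.mp hp)).isMaximal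
        (by rw [ne_eq, Ideal.span_singleton_eq_bot]; exact_mod_cast hp.ne_zero)
  haveI : IsGaloisGroup (K ≃ₐ[ℚ] K) ℤ (𝓞 K) := IsGaloisGroup.of_isFractionRing _ _ _ ℚ K
  have hfv : v.asIdeal.inertiaDeg ℤ = 1 := by
    have h := Ideal.pow_inertiaDeg p v.asIdeal
    refine Nat.pow_right_injective hp.two_le ?_
    beta_reduce
    rw [h, pow_one, ← hpdef]
  have hall : ∀ f ∈ splittingType K p, f = 1 := by
    intro f hf
    rw [splittingType_def] at hf
    obtain ⟨P, hP, rfl⟩ := Multiset.mem_map.mp hf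
    have hPmem := Multiset.mem_dedup.mp hP
    have hPprime : P.IsPrime := Ideal.isPrime_of_prime (prime_of_normalized_factor P hPmem)
    have hPdvd : P ∣ Ideal.span {(p : 𝓞 K)} := dvd_of_mem_normalizedFactors hPmem
    have hpP : (p : 𝓞 K) ∈ P := Ideal.le_of_dvd hPdvd (Ideal.mem_span_singleton_self _)
    haveI := hPprime
    haveI : P.LiesOver (Ideal.span {(p : ℤ)}) := liesOver_span_of_natCast_mem hp hpP
    rw [Ideal.inertiaDeg_eq_of_isGaloisGroup (Ideal.span {(p : ℤ)}) P v.asIdeal (K ≃ₐ[ℚ] K)]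
    exact hfv
  have hrep : splittingType K p = Multiset.replicate (Multiset.card (splittingType K p)) 1 :=
    Multiset.eq_replicate.mpr ⟨rfl, hall⟩
  have hsum := sum_splittingType_eq_finrank (K := K) hp hd
  rw [hrep, Multiset.sum_replicate, smul_eq_mul, mul_one] at hsum
  rw [hrep, hsum]

end Galois

/-! ### Degree-one primes with prescribed norm residue, away from the discriminant -/

/-- **A degree-one prime `𝔭 ∤ q d_K` with `N𝔭 ≡ N𝔞 (mod q)` and `N𝔭 ≤ (|d_K| q)^{L(n)}`**, for every number field `K`
of degree `n > 1`, every `q ≥ 1` and every nonzero ideal `𝔞` prime to `q`.  Proof: a prime `𝔴 ∤ q` with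
`N𝔴 ≡ N𝔞 (mod q)` of norm `> |d_K|^n` (file XIV, short intervals) is prime to `q d_K`; then file XII at level
`q·|d_K|` with the ideal `𝔴`. [cite: Weiss1983, Theorem 6.4] [cite: ThornerZaman2017, Theorem 3.1] -/
theorem exists_degOnePrime_absNorm_modEq_not_dvd_discr (n : ℕ) (hn : 1 < n) :
    ∃ L : ℝ, 0 < L ∧ ∀ (K : Type) [Field K] [NumberField K], Module.finrank ℚ K = n →
    ∀ q : ℕ, q ≠ 0 → ∀ I : Ideal (𝓞 K), I ≠ ⊥ → IsCoprime I (Ideal.span {(q : 𝓞 K)}) →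
      ∃ v : HeightOneSpectrum (𝓞 K), (q : 𝓞 K) ∉ v.asIdeal ∧ (Ideal.absNorm v.asIdeal).Prime ∧
        Ideal.absNorm v.asIdeal ≡ Ideal.absNorm I [MOD q] ∧
        ¬ ((Ideal.absNorm v.asIdeal : ℕ) : ℤ) ∣ NumberField.discr K ∧
        (Ideal.absNorm v.asIdeal : ℝ) ≤ (|(NumberField.discr K : ℝ)| * q) ^ L := by
  obtain ⟨δ, L₁, hδ, -, hF⟩ := exists_prime_absNorm_modEq_mem_Ioc n hn
  obtain ⟨L₂, hL₂, hB⟩ := exists_degOnePrime_absNorm_modEq n hn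
  refine ⟨2 * L₂, by positivity, fun K _ _ hKn q hq0 I hI hcop ↦ ?_⟩
  set D : ℕ := (NumberField.discr K).natAbs with hDdef
  have hD0 : D ≠ 0 := Int.natAbs_ne_zero.mpr (NumberField.discr_ne_zero K)
  have hDR : ((D : ℕ) : ℝ) = |(NumberField.discr K : ℝ)| := by
    rw [hDdef, ← Int.cast_natCast (R := ℝ), Int.natCast_natAbs, Int.cast_abs]
  have hD1 : (1 : ℝ) ≤ |(NumberField.discr K : ℝ)| := by
    rw [← hDR]; exact_mod_cast Nat.one_le_iff_ne_zero.mpr hD0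
  have hq1 : (1 : ℝ) ≤ q := by exact_mod_cast Nat.one_le_iff_ne_zero.mpr hq0
  have hb1 : (1 : ℝ) ≤ |(NumberField.discr K : ℝ)| * q := by nlinarith
  -- Step 1: an auxiliary prime `𝔴 ∤ q`, `N𝔴 ≡ N𝔞 (mod q)`, of norm `> |d_K|^n` (hence prime to `d_K`)
  set x : ℝ := (|(NumberField.discr K : ℝ)| * q) ^ (max L₁ n : ℝ) with hxdef
  have hx1 : (1 : ℝ) ≤ x := Real.one_le_rpow hb1 (by positivity)
  have hxL : (|(NumberField.discr K : ℝ)| * q) ^ L₁ ≤ x := Real.rpow_le_rpow_of_exponent_le hb1 (le_max_left _ _)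
  have hxn : ((D : ℕ) : ℝ) ^ n ≤ x := by
    calc ((D : ℕ) : ℝ) ^ n ≤ (|(NumberField.discr K : ℝ)| * q) ^ n := by
          rw [hDR]; exact pow_le_pow_left₀ (by positivity) (by nlinarith) n
      _ = (|(NumberField.discr K : ℝ)| * q) ^ ((n : ℕ) : ℝ) := (Real.rpow_natCast _ _).symm
      _ ≤ x := Real.rpow_le_rpow_of_exponent_le hb1 (le_max_right _ _)
  have hhx : x ^ (1 - δ) ≤ x := by
    have := Real.rpow_le_rpow_of_exponent_le hx1 (by linarith : 1 - δ ≤ 1)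
    rwa [Real.rpow_one] at this
  obtain ⟨w, hqw, hwres, hwlo, -⟩ := hF K hKn q hq0 I hI hcop x x hxL hhx le_rfl
  have hDw : ((D : ℕ) : 𝓞 K) ∉ w.asIdeal := by
    intro h1
    -- `D ∈ 𝔴` forces `N𝔴 ∣ D^n`, contradicting `N𝔴 > x ≥ D^n`
    have hle : Ideal.span {((D : ℕ) : 𝓞 K)} ≤ w.asIdeal := (Ideal.span_singleton_le_iff_mem _).mpr h1
    have hdvd : Ideal.absNorm w.asIdeal ∣ D ^ Module.finrank ℚ K := by
      rw [← absNorm_span_natCast]; exact Ideal.absNorm_dvd_absNorm_of_le hle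
    have hle' : (Ideal.absNorm w.asIdeal : ℝ) ≤ ((D : ℕ) : ℝ) ^ n := by
      rw [← hKn]; exact_mod_cast Nat.le_of_dvd (pow_pos (Nat.pos_of_ne_zero hD0) _) hdvd
    linarith
  have hqDw : ((q * D : ℕ) : 𝓞 K) ∉ w.asIdeal := by
    rw [Nat.cast_mul]
    intro hmem
    rcases w.isPrime.mem_or_mem hmem with h1 | h1
    · exact hqw h1
    · exact hDw h1
  have hwcop : IsCoprime w.asIdeal (Ideal.span {((q * D : ℕ) : 𝓞 K)}) := by
    rw [Ideal.isCoprime_iff_sup_eq]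
    by_contra hne
    have heq := w.isMaximal.eq_of_le hne le_sup_left
    apply hqDw
    rw [heq]
    exact Ideal.mem_sup_right (Ideal.mem_span_singleton_self _)
  -- Step 2: file XII at level `q·|d_K|` with the ideal `𝔴`
  obtain ⟨v, hm, hprime, hres, hle⟩ := hB K hKn (q * D) (mul_ne_zero hq0 hD0) w.asIdeal w.ne_bot hwcop
  haveI := v.isPrime
  set p : ℕ := Ideal.absNorm v.asIdeal with hpdef
  have hpv : (p : 𝓞 K) ∈ v.asIdeal := Ideal.absNorm_mem v.asIdeal
  refine ⟨v, fun h1 ↦ hm ?_, hprime, (hres.of_mul_right D).trans hwres, fun hdvd ↦ hm ?_, ?_⟩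
  · rw [Nat.cast_mul]; exact Ideal.mul_mem_right _ _ h1
  · have h1 : (p : ℤ) ∣ (D : ℤ) := by rw [hDdef, Int.dvd_natAbs]; exact hdvd
    obtain ⟨k, hk⟩ := Int.natCast_dvd_natCast.mp h1
    rw [Nat.cast_mul, hk, Nat.cast_mul]
    exact Ideal.mul_mem_left _ _ (Ideal.mul_mem_right _ _ hpv)
  · have hb0 : 0 ≤ |(NumberField.discr K : ℝ)| * q := by positivity
    refine hle.trans ?_
    rw [Nat.cast_mul, hDR, Real.rpow_mul hb0, Real.rpow_two]
    apply Real.rpow_le_rpow (by positivity) _ hL₂.le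
    calc |(NumberField.discr K : ℝ)| * (q * |(NumberField.discr K : ℝ)|)
        = |(NumberField.discr K : ℝ)| ^ 2 * q * 1 := by ring
      _ ≤ |(NumberField.discr K : ℝ)| ^ 2 * q * q := by gcongr
      _ = (|(NumberField.discr K : ℝ)| * q) ^ 2 := by ring

/-- **A prime `p ≡ 1 (mod m)`, `p ∤ d_K`, below a degree-one prime of `K`, with `p ≤ (|d_K| m)^{L(n)}`** — for every
number field `K` of degree `n > 1` and every `m ≥ 1`. [cite: Weiss1983, Theorem 6.4] [cite: ThornerZaman2017, Theorem 3.1] -/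
theorem exists_prime_modEq_one_of_degOne (n : ℕ) (hn : 1 < n) :
    ∃ L : ℝ, 0 < L ∧ ∀ (K : Type) [Field K] [NumberField K], Module.finrank ℚ K = n →
    ∀ m : ℕ, m ≠ 0 →
      ∃ v : HeightOneSpectrum (𝓞 K), (m : 𝓞 K) ∉ v.asIdeal ∧ (Ideal.absNorm v.asIdeal).Prime ∧
        Ideal.absNorm v.asIdeal ≡ 1 [MOD m] ∧
        ¬ ((Ideal.absNorm v.asIdeal : ℕ) : ℤ) ∣ NumberField.discr K ∧
        (Ideal.absNorm v.asIdeal : ℝ) ≤ (|(NumberField.discr K : ℝ)| * m) ^ L := by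
  obtain ⟨L, hL, h⟩ := exists_degOnePrime_absNorm_modEq_not_dvd_discr n hn
  refine ⟨L, hL, fun K _ _ hKn m hm0 ↦ ?_⟩
  have hcop : IsCoprime (⊤ : Ideal (𝓞 K)) (Ideal.span {(m : 𝓞 K)}) := by
    rw [← Ideal.one_eq_top]; exact isCoprime_one_left
  obtain ⟨v, hm, hprime, hres, hd, hle⟩ := h K hKn m hm0 ⊤ top_ne_bot hcop
  exact ⟨v, hm, hprime, by simpa only [Ideal.absNorm_top] using hres, hd, hle⟩

/-! ### Linnik for the primes in an arithmetic progression splitting completely in a Galois field -/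

/-- **Linnik's theorem for the primes `p ≡ a (mod q)` that split completely in a Galois number field** (see the module
docstring): for `n > 1` there is `L = L(n) > 0` such that for every Galois number field `K/ℚ` of degree `n`, every
`q ≥ 1` and every residue `a ≡ N𝔞 (mod q)` attained by an ideal `𝔞 ≠ 0` of `𝓞 K` prime to `q` (the residues not so
attained carry no prime splitting completely in `K` at all, except possibly divisors of `q`), there is a prime
`p ≡ a (mod q)`, `p ∤ d_K`, splitting completely in `K` (`splittingType K p = {1,…,1}`), with `p ≤ (|d_K| q)^L`.
[cite: Weiss1983, Theorem 6.4] [cite: ThornerZaman2017, Theorem 1.1] -/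
theorem exists_prime_modEq_splittingType_eq_replicate (n : ℕ) (hn : 1 < n) :
    ∃ L : ℝ, 0 < L ∧ ∀ (K : Type) [Field K] [NumberField K] [IsGalois ℚ K], Module.finrank ℚ K = n →
    ∀ q : ℕ, q ≠ 0 → ∀ I : Ideal (𝓞 K), I ≠ ⊥ → IsCoprime I (Ideal.span {(q : 𝓞 K)}) →
      ∃ p : ℕ, p.Prime ∧ p ≡ Ideal.absNorm I [MOD q] ∧ ¬ ((p : ℤ) ∣ NumberField.discr K) ∧
        splittingType K p = Multiset.replicate n 1 ∧ (p : ℝ) ≤ (|(NumberField.discr K : ℝ)| * q) ^ L := by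
  obtain ⟨L, hL, h⟩ := exists_degOnePrime_absNorm_modEq_not_dvd_discr n hn
  refine ⟨L, hL, fun K _ _ _ hKn q hq0 I hI hcop ↦ ?_⟩
  obtain ⟨v, -, hprime, hres, hd, hle⟩ := h K hKn q hq0 I hI hcop
  refine ⟨Ideal.absNorm v.asIdeal, hprime, hres, hd, ?_, hle⟩
  rw [← hKn]
  exact splittingType_eq_replicate_one_of_prime_absNorm v hprime hd

/-- **Linnik's theorem for the primes `p ≡ 1 (mod m)` splitting completely in a Galois number field**: for `n > 1`
there is `L = L(n) > 0` such that for every Galois number field `K/ℚ` of degree `n` and every `m ≥ 1` there is a prime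
`p ≡ 1 (mod m)`, `p ∤ d_K`, with `splittingType K p = {1,…,1}` and `p ≤ (|d_K| m)^L` — the least prime splitting
completely in `K(ζ_m)` is `≤ (|d_K| m)^{L(n)}`. [cite: Weiss1983, Theorem 6.4] [cite: ThornerZaman2017, Theorem 1.1] -/
theorem exists_prime_modEq_one_splittingType_eq_replicate (n : ℕ) (hn : 1 < n) :
    ∃ L : ℝ, 0 < L ∧ ∀ (K : Type) [Field K] [NumberField K] [IsGalois ℚ K], Module.finrank ℚ K = n →
    ∀ m : ℕ, m ≠ 0 → ∃ p : ℕ, p.Prime ∧ p ≡ 1 [MOD m] ∧ ¬ ((p : ℤ) ∣ NumberField.discr K) ∧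
      splittingType K p = Multiset.replicate n 1 ∧ (p : ℝ) ≤ (|(NumberField.discr K : ℝ)| * m) ^ L := by
  obtain ⟨L, hL, h⟩ := exists_prime_modEq_one_of_degOne n hn
  refine ⟨L, hL, fun K _ _ _ hKn m hm0 ↦ ?_⟩
  obtain ⟨v, -, hprime, hres, hd, hle⟩ := h K hKn m hm0
  refine ⟨Ideal.absNorm v.asIdeal, hprime, hres, hd, ?_, hle⟩
  rw [← hKn]
  exact splittingType_eq_replicate_one_of_prime_absNorm v hprime hd

/-! ### The norm-residue group -/

/-- **The norm residues `mod m` of `K` are exactly `χ_m(Gal(K(ζ_m)/K))`, and each is the residue of a degree-one prime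
of norm `≤ (|d_K| m)^{L(n)}`**: for `u ∈ (ℤ/m)ˣ`, `u ∈ χ_m(Gal(K(ζ_m)/K))` iff `u ≡ N𝔭 (mod m)` for some prime `𝔭 ∌ m`
of `K` of residue degree one with `N𝔭 ≤ (|d_K| m)^L` (weak Chebotarev for `K(ζ_m)/K`, made effective).
[cite: TateGCFT1967, Ch. VII §3.4] [cite: Weiss1983, Theorem 6.4] -/
theorem mem_range_cycloChar_iff_exists_degOnePrime (n : ℕ) (hn : 1 < n) :
    ∃ L : ℝ, 0 < L ∧ ∀ (K : Type) [Field K] [NumberField K], Module.finrank ℚ K = n →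
    ∀ (m : ℕ) [NeZero m] (N : Type) [Field N] [NumberField N] [Algebra K N] [IsCyclotomicExtension {m} K N],
      ∀ u : (ZMod m)ˣ, u ∈ (cycloChar K N m).range ↔
        ∃ v : HeightOneSpectrum (𝓞 K), (m : 𝓞 K) ∉ v.asIdeal ∧ (Ideal.absNorm v.asIdeal).Prime ∧
          (Ideal.absNorm v.asIdeal : ℝ) ≤ (|(NumberField.discr K : ℝ)| * m) ^ L ∧
          ((Ideal.absNorm v.asIdeal : ℕ) : ZMod m) = (u : ZMod m) := by
  obtain ⟨L, hL, h⟩ := exists_degOnePrime_frobenius_eq_of_isCyclotomicExtension n hn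
  refine ⟨L, hL, fun K _ _ hKn m _ N _ _ _ _ u ↦ ⟨?_, ?_⟩⟩
  · rintro ⟨σ, rfl⟩
    obtain ⟨v, hm, -, hprime, hle, hres, -⟩ := h K hKn m N σ
    exact ⟨v, hm, hprime, hle, hres⟩
  · rintro ⟨v, hm, -, -, hres⟩
    haveI := isGalois_of_isCyclotomicExtension K N m
    refine ⟨galFrob K N v, Units.ext ?_⟩
    rw [val_cycloChar_galFrob K N m v hm, hres]

end Summit.QuantumAdvantage.QuantumAdvantage.Theorems.DegreeOnePrimesEscape

end
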